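import Literature.MathematicalPhysics.QuantumFieldTheory.Balaban1983to89.B6Lemma24Kappa
import Literature.MathematicalPhysics.QuantumFieldTheory.Balaban1983to89.B5Eq155FlatAveragingCommute

/-!
# `Balaban1983to89.NodeOTorusBlocks` — T. Bałaban, *Averaging operations for lattice gauge theories*, CMP **98** (1985) 17–51 [Balaban1985Averaging]
# (1)–(2) p. 17 (periodic configurations, blocks `B(y)`), with [Balaban1984PropagatorsI] (1.4)–(1.7) p. 18, [Balaban1984PropagatorsII] (2.121), (2.125)
# pp. 244–245 and [Balaban1985BackgroundPropagators] (3.35)–(3.36) p. 396: **THE PERIODIC LIFT OF TORUS BOND FIELDS TO `ℤ^d` — BOXES, REPRESENTATIVES,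
# BLOCK COORDINATES, THE LIFTED REGION `B(Λ′)` AND ITS WINDOW** (bookkeeping for `NodeOTorusLemma24`)

statement-level skeleton of published theorems with citation tags; proofs where landed; nothing here is a claim about the Yang–Mills mass gap

CITATION HEADER (lean-in-tree rule).  Ideation cell `ym-nodeO-ideate` (portfolio track, 2026-08-25), seat P1 «inside Bałaban», memo
`memos/ROUTE-P1.md` v3.17 (sha256 d4d6d9a6…) §0q (FINDINGS F10∕F11) and §0p (F9).  LANDING EDITION (generation 12, F-series module 1∕5) of the memo
companion `memos/ROUTE-P1-SketchLift.lean` («companion 8», sha256 429c7622…, 597 l., 0 `sorry`; farm `lean check` rc 0, axioms standard) §1–§4 (lines 62–375); referee track = the cell's `STATUS.md` (REF∕LIT verdict lines on v3.17 and on this edition are the filing precondition; the courier files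
REF-named editions only, unchanged; director-ym LINE №2 (B), operator 2026-08-25T18:24:34Z).  Statements and proofs below are CHARACTER-IDENTICAL to the
companion's; edition deltas = the namespace (`YMNodeOIdeate.P1.Lift` → this module's), this header, the closing `end Lift` of the companion's section (its §5 continues in module 2 `NodeOTorusLemma24`, which re-opens the section with the same `variable` line), the companion's `open …Balaban1983to89` line dropped
(the opens now resolve inside the tree namespace), bare `Plaq`∕`block` spelled `B9SectCLatticeCarrier.Plaq`∕`B6Elimination.block` in code (inside the tree
namespace the topic root's `Setup.lean` `Plaq`∕`block` shadow the opens),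
for the gate lint `literature-cited-only` (LIT pre-flight 2026-08-25T20:35:30Z: `[folklore]` alone only on private helpers) 3 same-module helper(s) marked `private`
(`rep_mem_box`, `rep_perSite`, `key_arith`) and 2 cross-module helper(s) given a serving cite tag next to `[folklore]` (`mem_box`, `unitVec_eq_e`), and nothing else.  EACH `[cite:]` TAG NAMES THE PRINTED DISPLAY THE DECLARATION SERVES OR TRANSCRIBES —
the proofs are finite-sum bookkeeping ∕ linear algebra of ours; print proves none of them as stated.  Sources READ (renders, LIT `lit/SOURCES.md` v2.75):
[Balaban1985Averaging] p. 17, p. 19; [Balaban1984PropagatorsI] p. 18; [Balaban1984PropagatorsII] = CMP **96** pp. 244–245; [Balaban1985BackgroundPropagators] p. 396.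

PRINT STATUS.  Print works on the torus `T_η` with periodic fields and `L`-blocks ((1)–(2) p. 17; (1.4)–(1.7) p. 18; (3.4) p. 391) and proves [Balaban1984PropagatorsII]
Lemma 2.4 on regions `B(Λ′) ⊂ ℤ^d` (p. 245); the identification «periodic field on the torus, supported in a window of `(2ρ+1)^d` blocks with `2ρ + 3 ≤ m`» ↔
«field on `ℤ^d` supported in `B(Λ′)`, no wrap-around» that [Balaban1985BackgroundPropagators] p. 428 uses silently («We have proved it in [4], Lemma 2.4, for
operators with U = 1») is displayed nowhere; this module is that identification's arithmetic (no estimate).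

WHAT IS PROVED (sorry-free; standard axioms; `d`-generic).  §1 `curlSum`, `qSum` (the flat plaquette circulation and the (2.125) double sum, unnormalised).
§2 `box`∕`mem_box`, `perSite_val`∕`perSite_add`, **`perSite_injOn`** (the periodic reading is injective on every box of periods), `rep`∕`rep_mem_box`∕`perSite_rep`∕
`rep_perSite`, `sum_torus_eq_sum_box` (a torus sum is the sum over any fundamental box).  §3 `unitVec_eq_e`, `sum_block_eq_sum_boxVec`, `key_arith`.
§4 `ytil`, `Rbox`, **`BZ`** (the lift `B^ℤ = 1_R·(B ∘ perSite)`), `LamOf` (the lifted block set `Λ′`), **`axialTrees`** (the torus image of the block axial trees (2.121)),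
`perSite_ytil`, `ytil_blockCoord_perSite`, **`mem_lam_of_blockCoord`** (KEY: a fine site of the fundamental box whose torus block lies in `Y` lies in `B(Λ′)`),
**`window`** (`Λ′` sits `≥ L` inside the fundamental box when `Y ⊂ y₁ + [1, 2ρ+1]^d`, `2ρ + 3 ≤ m`), `perSite_Lmul_add`, **`coarse_facts`** (coarse bonds of `Λ′`:
window position and torus image).

WHAT THIS IS NOT.  Not NODE O (`B13TermWalkDataOneTorus.ExistsUniformAcrossSmall`, :353), not [Balaban1987RG1] Thm 2 + (0.31) p. 259, not the `γ₀`
sentence of [Balaban1985BackgroundPropagators] p. 428 (whose road is `NodeOGamma0Road.hcoer_of_letters` MODULO its letters), not a new estimate: the torus form of (2.128) itself is module 2.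
-/

open scoped BigOperators

noncomputable section

namespace Literature.MathematicalPhysics.QuantumFieldTheory.Balaban1983to89.NodeOTorusBlocks

open B4Sect5Torus (TSite)
open B9SectCLatticeCarrier (Bond Plaq DirPair shift bpos)
open B7Prop1Explicit (e boxVec)
open B9Eq319QprimeTorus (fineP blockCoord blockCoord_apply_val)
open B9Eq315QTorusOnto (liftSite periodVec perSite_add_periodVec perSite_liftSite)
open B9Eq315QTorus (perSite cornerSite)
open B5Eq155FlatAveragingCommute (shift_perSite)
open B6Elimination (block mem_block)
open B6BondElimination (unitVec contour)
open B6TreeGaugePoincare (Cfg curl)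
open B6Lemma24Carrier (lam mem_lam lamBonds mem_lamBonds lamPlaq mem_lamPlaq lamPlaqBase coarseBonds)
open B6Lemma24PrintedShape (segSum q1 contourSum contourSum_eq_zero_of_bondwise)
open B6Lemma24Kappa (lemma24_printedShape_kappa1)
open B6LayerPoincarePair (kappa1 kappa1_pos)

variable {d : ℕ}

/-! ## §1  The explicit sums -/

section Defs

variable {P : Fin d → ℕ} {V : Type*} [AddCommGroup V]

/-- The flat circulation of `F` around the plaquette `p = (x, {μ < ν})`. [cite: Balaban1984PropagatorsI, (1.4) p.18] -/
def curlSum (F : Bond d P → V) (p : B9SectCLatticeCarrier.Plaq d P) : V :=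
  F (shift p.2.1.1 p.1, p.2.1.2) - F (p.1, p.2.1.2) - (F (shift p.2.1.2 p.1, p.2.1.1) - F (p.1, p.2.1.1))

variable (L : ℕ) (m : Fin d → ℕ) [∀ i, NeZero (fineP L m i)]

/-- The (2.125) double sum without its normalisation at the coarse bond `(y, κ)`. [cite: Balaban1984PropagatorsII, (2.125) p.245] -/
def qSum (F : Bond d (fineP L m) → V) (c : Bond d m) : V :=
  ∑ r : Fin d → Fin L, ∑ i ∈ Finset.range L, F (perSite (fineP L m) (cornerSite L c.1 + boxVec L r + (i : ℤ) • e c.2), c.2)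

end Defs

/-! ## §2  Torus arithmetic: boxes, representatives, reindexing the torus by a fundamental box -/

section Torus

variable (P : Fin d → ℕ) [∀ i, NeZero (P i)]

/-- The coordinates of the periodic reading. [cite: Balaban1985Averaging, (1) p.17] -/
theorem perSite_val (x : Fin d → ℤ) (i : Fin d) : ((perSite P x i : ℕ) : ℤ) = x i % (P i : ℤ) := by
  have hP : (0 : ℤ) < (P i : ℤ) := by exact_mod_cast Nat.pos_of_ne_zero (NeZero.ne (P i))
  simp only [perSite, Int.toNat_of_nonneg (Int.emod_nonneg _ hP.ne')]

/-- The periodic reading is additive. [cite: Balaban1985Averaging, (1) p.17] -/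
theorem perSite_add (a b : Fin d → ℤ) : perSite P (a + b) = perSite P a + perSite P b := by
  funext i
  apply Fin.ext
  rw [Pi.add_apply, Fin.val_add]
  simp only [perSite, Pi.add_apply]
  have hP : (0 : ℤ) < (P i : ℤ) := by exact_mod_cast Nat.pos_of_ne_zero (NeZero.ne (P i))
  have ha := Int.emod_nonneg (a i) hP.ne'
  have hb := Int.emod_nonneg (b i) hP.ne'
  have hab := Int.emod_nonneg (a i + b i) hP.ne'
  apply Int.ofNat_inj.mp
  push_cast
  rw [Int.toNat_of_nonneg hab, Int.toNat_of_nonneg ha, Int.toNat_of_nonneg hb]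
  exact Int.add_emod _ _ _

/-- The box `Π_i [lo_i, lo_i + P_i)` of `ℤ^d`. [folklore] -/
def box (lo : Fin d → ℤ) (P : Fin d → ℕ) : Finset (Fin d → ℤ) :=
  Fintype.piFinset fun i => Finset.Ico (lo i) (lo i + P i)

omit [∀ i, NeZero (P i)] in
/-- Membership in a box, coordinate form. [cite: Balaban1985BackgroundPropagators, (3.4) p.391] [folklore] -/
theorem mem_box {lo : Fin d → ℤ} {z : Fin d → ℤ} : z ∈ box lo P ↔ ∀ i, lo i ≤ z i ∧ z i < lo i + P i := by
  simp only [box, Fintype.mem_piFinset, Finset.mem_Ico]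

/-- **The periodic reading is injective on every box of periods.** [cite: Balaban1985Averaging, (1) p.17] -/
theorem perSite_injOn {lo : Fin d → ℤ} {z z' : Fin d → ℤ} (hz : z ∈ box lo P) (hz' : z' ∈ box lo P)
    (h : perSite P z = perSite P z') : z = z' := by
  rw [mem_box] at hz hz'
  funext i
  have hP : (0 : ℤ) < (P i : ℤ) := by exact_mod_cast Nat.pos_of_ne_zero (NeZero.ne (P i))
  have hmod : z i % (P i : ℤ) = z' i % (P i : ℤ) := by
    rw [← perSite_val P z i, ← perSite_val P z' i, h]
  have e1 := Int.emod_add_mul_ediv (z i) (P i : ℤ)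
  have e2 := Int.emod_add_mul_ediv (z' i) (P i : ℤ)
  obtain ⟨h1, h2⟩ := hz i
  obtain ⟨h1', h2'⟩ := hz' i
  have hq : (P i : ℤ) * (z i / P i - z' i / P i) < P i * 1 := by rw [mul_sub]; linarith
  have hq' : (P i : ℤ) * (z' i / P i - z i / P i) < P i * 1 := by rw [mul_sub]; linarith
  have a1 := lt_of_mul_lt_mul_left hq hP.le
  have a2 := lt_of_mul_lt_mul_left hq' hP.le
  have hqq : z i / P i = z' i / P i := by omega
  calc z i = z i % P i + P i * (z i / P i) := e1.symm
    _ = z' i % P i + P i * (z' i / P i) := by rw [hmod, hqq]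
    _ = z' i := e2

/-- The representative of a torus site in the box `Π_i [lo_i, lo_i + P_i)`. [cite: Balaban1985Averaging, (1) p.17] -/
def rep (lo : Fin d → ℤ) (x : TSite d P) : Fin d → ℤ := fun i => lo i + (liftSite x i - lo i) % (P i : ℤ)

/-- The representative lies in the box. [folklore] -/
private theorem rep_mem_box (lo : Fin d → ℤ) (x : TSite d P) : rep P lo x ∈ box lo P := by
  rw [mem_box]
  intro i
  have hP : (0 : ℤ) < (P i : ℤ) := by exact_mod_cast Nat.pos_of_ne_zero (NeZero.ne (P i))
  refine ⟨?_, ?_⟩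
  · simp only [rep]; linarith [Int.emod_nonneg (liftSite x i - lo i) hP.ne']
  · simp only [rep]; linarith [Int.emod_lt_of_pos (liftSite x i - lo i) hP]

/-- The representative reads back to the site. [cite: Balaban1985Averaging, (1) p.17] -/
theorem perSite_rep (lo : Fin d → ℤ) (x : TSite d P) : perSite P (rep P lo x) = x := by
  have e : rep P lo x = liftSite x + periodVec P (fun i => -((liftSite x i - lo i) / (P i : ℤ))) := by
    funext i
    simp only [rep, periodVec, Pi.add_apply, Int.emod_def]
    ring
  rw [e, perSite_add_periodVec, perSite_liftSite]

/-- The representative of the reading of a box point is the point. [folklore] -/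
private theorem rep_perSite {lo : Fin d → ℤ} {z : Fin d → ℤ} (hz : z ∈ box lo P) : rep P lo (perSite P z) = z :=
  perSite_injOn P (rep_mem_box P lo _) hz (perSite_rep P lo _)

/-- **Reindexing the torus by a fundamental box**: `Σ_{x ∈ torus} g(x) = Σ_{z ∈ Π[lo, lo+P)} g(z mod P)`.
[cite: Balaban1985Averaging, (1) p.17] -/
theorem sum_torus_eq_sum_box {M : Type*} [AddCommMonoid M] (lo : Fin d → ℤ) (g : TSite d P → M) :
    ∑ x, g x = ∑ z ∈ box lo P, g (perSite P z) :=
  Finset.sum_nbij' (rep P lo) (perSite P) (fun x _ => rep_mem_box P lo x) (fun _ _ => Finset.mem_univ _)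
    (fun x _ => perSite_rep P lo x) (fun z hz => rep_perSite P hz) (fun x _ => by rw [perSite_rep])

end Torus

/-! ## §3  `ℤ^d` bookkeeping: unit vectors, block sums, the key arithmetic lemma -/

/-- The two unit vectors of the tree agree: `B6BondElimination.unitVec μ = B7Prop1Explicit.e μ`. [cite: Balaban1985Averaging, (125) p.36] [folklore] -/
theorem unitVec_eq_e (μ : Fin d) : (unitVec μ : Fin d → ℤ) = e μ := by
  funext i
  simp only [unitVec, e, Pi.single_apply]

/-- The `ℤ^d` block `B(y) = y + [0,L)^d` as an image: `Σ_{x ∈ B(y)} f(x) = Σ_{r ∈ [0,L)^d} f(y + r)`. [cite: Balaban1984PropagatorsI, (1.6) p.18] -/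
theorem sum_block_eq_sum_boxVec {M : Type*} [AddCommMonoid M] {L : ℕ} (hL : 0 < L) (y : Fin d → ℤ)
    (f : (Fin d → ℤ) → M) : ∑ x ∈ B6Elimination.block L y, f x = ∑ r : Fin d → Fin L, f (y + boxVec L r) := by
  symm
  refine Finset.sum_nbij' (fun r => y + boxVec L r) (fun x i => ⟨(x i - y i).toNat % L, Nat.mod_lt _ hL⟩)
    ?_ ?_ ?_ ?_ ?_
  · intro r _
    rw [mem_block]
    intro i
    have h := (r i).isLt
    simp only [Pi.add_apply, boxVec]
    constructor <;> omega
  · intro _ _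
    exact Finset.mem_univ _
  · intro r _
    funext i
    apply Fin.ext
    simp only [Pi.add_apply, boxVec, add_sub_cancel_left, Int.toNat_natCast, Nat.mod_eq_of_lt (r i).isLt]
  · intro x hx
    rw [mem_block] at hx
    funext i
    obtain ⟨h1, h2⟩ := hx i
    have h0 : 0 ≤ x i - y i := by linarith
    have h3 : (x i - y i).toNat < L := by
      have : (((x i - y i).toNat : ℕ) : ℤ) < L := by rw [Int.toNat_of_nonneg h0]; linarith
      exact_mod_cast this
    simp only [Pi.add_apply, boxVec, Nat.mod_eq_of_lt h3, Int.toNat_of_nonneg h0]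
    ring
  · intro _ _
    rfl

/-- **The key arithmetic lemma of the lift** (one coordinate): for `0 < L`, `0 ≤ a < m`, `L a ≤ z < L a + L m`:
`a + ((z mod Lm) div L − a) mod m = z div L`. [folklore] -/
private theorem key_arith {L m a z : ℤ} (hL : 0 < L) (hz1 : L * a ≤ z) (hz2 : z < L * a + L * m) :
    a + (z % (L * m) / L - a) % m = z / L := by
  have hw1 : a ≤ z / L := Int.le_ediv_of_mul_le hL (by linarith [mul_comm L a])
  have hw2 : z / L < a + m := Int.ediv_lt_of_lt_mul hL (by linarith [show (a + m) * L = L * a + L * m by ring])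
  have hr : z % (L * m) = z + L * (-(m * (z / (L * m)))) := by rw [Int.emod_def]; ring
  have hdiv : z % (L * m) / L = z / L + -(m * (z / (L * m))) := by
    rw [hr, Int.add_mul_ediv_left _ _ hL.ne']
  have hmod : (z / L + -(m * (z / (L * m))) - a) % m = (z / L - a) % m := by
    have : z / L + -(m * (z / (L * m))) - a = (z / L - a) + m * (-(z / (L * m))) := by ring
    rw [this, Int.add_mul_emod_self_left]
  rw [hdiv, hmod, Int.emod_eq_of_lt (by linarith) (by linarith)]
  ring

/-! ## §4  The lift: `ỹ`, `Λ′`, the fundamental box `R`, `B^ℤ`, the axial trees -/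

section Lift

variable (L : ℕ) (m : Fin d → ℕ) [NeZero L] [∀ i, NeZero (m i)] [∀ i, NeZero (fineP L m i)]

/-- `ỹ(y) := liftSite y₁ + liftSite (y − y₁)` — the representative of the coarse site `y` in the window above `y₁`.
[cite: Balaban1985Averaging, (1)–(2) p.17] -/
def ytil (y₁ y : TSite d m) : Fin d → ℤ := liftSite y₁ + liftSite (y - y₁)

omit [NeZero L] [∀ i, NeZero (fineP L m i)] in
/-- `ỹ(y) ≡ y`. [cite: Balaban1985Averaging, (1) p.17] -/
theorem perSite_ytil (y₁ y : TSite d m) : perSite m (ytil m y₁ y) = y := by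
  rw [ytil, perSite_add, perSite_liftSite, perSite_liftSite, add_sub_cancel]

/-- The fundamental box of fine sites `R = Π_i [L a_i, L a_i + L m_i)`, `a = liftSite y₁`. [cite: Balaban1985Averaging, (1)–(2) p.17] -/
def Rbox (y₁ : TSite d m) : Finset (Fin d → ℤ) := box (cornerSite L y₁) (fineP L m)

/-- **The lifted configuration** `B^ℤ(z, μ) = 1_R(z)·B(z mod Lm, μ)`. [cite: Balaban1985Averaging, (1) p.17, p.19] -/
def BZ (y₁ : TSite d m) (B : Bond d (fineP L m) → ℝ) : Cfg d := fun b =>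
  if b.1 ∈ Rbox L m y₁ then B (perSite (fineP L m) b.1, b.2) else 0

/-- The lifted block set `Λ′ = {L·ỹ(y) : y ∈ Y}`. [cite: Balaban1984PropagatorsII, Lemma 2.4 p.245] -/
def LamOf (y₁ : TSite d m) (Y' : Finset (TSite d m)) : Finset (Fin d → ℤ) :=
  Y'.image fun y i => (L : ℤ) * ytil m y₁ y i

/-- **The axial trees on the fine torus**: the periodic image of all block contours `Γ_{y′,x}` ((1.7) of [B5]),
`y′ ∈ Lℤ^d`, `x ∈ B(y′)`. [cite: Balaban1984PropagatorsI, (1.7) p.18; Balaban1984PropagatorsII, (2.121) p.244] -/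
def axialTrees : Set (Bond d (fineP L m)) :=
  {bt | ∃ y' : Fin d → ℤ, (∀ i, (L : ℤ) ∣ y' i) ∧ ∃ x ∈ B6Elimination.block L y', ∃ b ∈ contour L y' x,
    bt = (perSite (fineP L m) b.1, b.2)}

/-- **The block coordinate of a box point, lifted**: for `z ∈ R`, `ỹ(blockCoord (z mod Lm)) = z div L`.
[cite: Balaban1985Averaging, (2) p.17] -/
theorem ytil_blockCoord_perSite (y₁ : TSite d m) {z : Fin d → ℤ} (hz : z ∈ Rbox L m y₁) (i : Fin d) :
    ytil m y₁ (blockCoord L m (perSite (fineP L m) z)) i = z i / L := by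
  set y := blockCoord L m (perSite (fineP L m) z) with hy
  have hL : (0 : ℤ) < L := by exact_mod_cast Nat.pos_of_ne_zero (NeZero.ne L)
  obtain ⟨hz1, hz2⟩ := (mem_box (fineP L m)).1 hz i
  have hc : cornerSite L y₁ i = L * ((y₁ i : ℕ) : ℤ) := rfl
  have hf : ((fineP L m i : ℕ) : ℤ) = L * m i := by simp only [fineP]; push_cast; ring
  rw [hc] at hz1 hz2
  rw [hf] at hz2
  -- the value of `y i`
  have hyv : ((y i : ℕ) : ℤ) = z i % (L * m i) / L := by
    have h1 : ((y i : ℕ) : ℤ) = (((perSite (fineP L m) z i : ℕ) / L : ℕ) : ℤ) := by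
      rw [hy, blockCoord_apply_val]
    rw [h1, Int.natCast_div, perSite_val, hf]
  -- the value of `(y - y₁) i`
  have hsub : ((((y - y₁) i : Fin (m i)) : ℕ) : ℤ) = (((y i : ℕ) : ℤ) - ((y₁ i : ℕ) : ℤ)) % m i := by
    have h := congrArg (fun t : TSite d m => (((t i : Fin (m i)) : ℕ) : ℤ)) (sub_add_cancel y y₁)
    simp only [Pi.add_apply, Fin.val_add] at h
    push_cast at h
    have h0 : (0 : ℤ) ≤ (((y - y₁) i : ℕ) : ℤ) := by positivity
    have h1 : (((y - y₁) i : ℕ) : ℤ) < m i := by exact_mod_cast ((y - y₁) i).isLt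
    rw [← h]
    symm
    rw [Int.sub_emod, Int.emod_emod, ← Int.sub_emod, add_sub_cancel_right, Int.emod_eq_of_lt h0 h1]
  -- assemble
  have e : ytil m y₁ y i = ((y₁ i : ℕ) : ℤ) + (((y - y₁) i : ℕ) : ℤ) := rfl
  rw [e, hsub, hyv]
  exact key_arith hL hz1 hz2

/-- **KEY**: a point of the fundamental box whose torus block lies in `Y` lies in `Λ = B(Λ′)`.
[cite: Balaban1984PropagatorsII, Lemma 2.4 p.245; Balaban1985Averaging, (2) p.17] -/
theorem mem_lam_of_blockCoord (y₁ : TSite d m) (Y' : Finset (TSite d m)) {z : Fin d → ℤ}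
    (hz : z ∈ Rbox L m y₁) (hy : blockCoord L m (perSite (fineP L m) z) ∈ Y') :
    z ∈ lam L (LamOf L m y₁ Y') := by
  rw [mem_lam]
  refine ⟨fun i => (L : ℤ) * ytil m y₁ (blockCoord L m (perSite (fineP L m) z)) i,
    Finset.mem_image.2 ⟨_, hy, rfl⟩, ?_⟩
  rw [mem_block]
  intro i
  rw [ytil_blockCoord_perSite L m y₁ hz i]
  have hL : (0 : ℤ) < L := by exact_mod_cast Nat.pos_of_ne_zero (NeZero.ne L)
  have e := Int.emod_add_mul_ediv (z i) (L : ℤ)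
  constructor <;> linarith [Int.emod_nonneg (z i) hL.ne', Int.emod_lt_of_pos (z i) hL]

omit [NeZero L] [∀ i, NeZero (m i)] [∀ i, NeZero (fineP L m i)] in
/-- **The window**: every `y′ ∈ Λ′` has `L a_i + L ≤ y′_i` and `y′_i + 2L ≤ L a_i + L m_i`, provided `Y` lies in the
box `y₁ + [1, 2ρ+1]^d` and `2ρ + 3 ≤ m_i`. [cite: Balaban1985BackgroundPropagators, (3.35)–(3.36) p.396] -/
theorem window {y₁ : TSite d m} {Y' : Finset (TSite d m)} {ρ : ℕ} (hfit : ∀ i, 2 * ρ + 3 ≤ m i)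
    (hY : ∀ y ∈ Y', ∀ i, 1 ≤ liftSite (y - y₁) i ∧ liftSite (y - y₁) i ≤ ((2 * ρ : ℕ) : ℤ) + 1)
    {y' : Fin d → ℤ} (hy' : y' ∈ LamOf L m y₁ Y') (i : Fin d) :
    cornerSite L y₁ i + L ≤ y' i ∧ y' i + 2 * L ≤ cornerSite L y₁ i + (fineP L m i : ℤ) := by
  obtain ⟨y, hy, rfl⟩ := Finset.mem_image.1 hy'
  obtain ⟨h1, h2⟩ := hY y hy i
  have hL : (0 : ℤ) ≤ L := by positivity
  have hm : (((2 * ρ + 3 : ℕ)) : ℤ) ≤ m i := by exact_mod_cast hfit i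
  have hf : ((fineP L m i : ℕ) : ℤ) = L * m i := by simp only [fineP]; push_cast; ring
  show cornerSite L y₁ i + L ≤ (L : ℤ) * ytil m y₁ y i ∧
    (L : ℤ) * ytil m y₁ y i + 2 * L ≤ cornerSite L y₁ i + (fineP L m i : ℤ)
  have hc : cornerSite L y₁ i = L * liftSite y₁ i := rfl
  have e : ytil m y₁ y i = liftSite y₁ i + liftSite (y - y₁) i := rfl
  rw [hf, hc, e]
  push_cast at hm h2
  have p1 := mul_le_mul_of_nonneg_left h1 hL
  have p2 := mul_le_mul_of_nonneg_left h2 hL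
  have p3 := mul_le_mul_of_nonneg_left hm hL
  constructor
  · nlinarith
  · nlinarith

omit [NeZero L] in
/-- **Periods**: `perSite_{Lm}(L·w + v) = perSite_{Lm}(cornerSite (w mod m) + v)`. [cite: Balaban1985Averaging, (1)–(2) p.17] -/
theorem perSite_Lmul_add (w v : Fin d → ℤ) :
    perSite (fineP L m) ((fun i => (L : ℤ) * w i) + v) = perSite (fineP L m) (cornerSite L (perSite m w) + v) := by
  have e : ((fun i => (L : ℤ) * w i) + v) =
      (cornerSite L (perSite m w) + v) + periodVec (fineP L m) (fun i => w i / (m i : ℤ)) := by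
    funext i
    have h := Int.emod_add_mul_ediv (w i) (m i : ℤ)
    have hc : cornerSite L (perSite m w) i = L * (w i % (m i : ℤ)) := by
      show (L : ℤ) * ((perSite m w i : ℕ) : ℤ) = _
      rw [perSite_val]
    simp only [Pi.add_apply, hc, periodVec]
    push_cast
    linear_combination (L : ℤ) * h.symm
  rw [e, perSite_add_periodVec]

omit [NeZero L] [∀ i, NeZero (m i)] [∀ i, NeZero (fineP L m i)] in
/-- **Coarse bonds of `Λ′`**: coordinates within `[L a_i, L a_i + L m_i − 2L]` and divisible by `L`.
[cite: Balaban1984PropagatorsII, Lemma 2.4 p.245] -/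
theorem coarse_facts {y₁ : TSite d m} {Y' : Finset (TSite d m)} {ρ : ℕ} (hfit : ∀ i, 2 * ρ + 3 ≤ m i)
    (hY : ∀ y ∈ Y', ∀ i, 1 ≤ liftSite (y - y₁) i ∧ liftSite (y - y₁) i ≤ ((2 * ρ : ℕ) : ℤ) + 1)
    {c : (Fin d → ℤ) × Fin d} (hc : c ∈ coarseBonds L (LamOf L m y₁ Y')) :
    (∀ i, cornerSite L y₁ i ≤ c.1 i ∧ c.1 i + 2 * L ≤ cornerSite L y₁ i + (fineP L m i : ℤ)) ∧
      ∀ i, c.1 i = L * (c.1 i / L) := by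
  have hL : (0 : ℤ) ≤ L := by positivity
  unfold coarseBonds at hc
  obtain ⟨y', hy', hcases⟩ : ∃ y' ∈ LamOf L m y₁ Y', c.1 = y' ∨ c.1 = y' - (L : ℤ) • unitVec c.2 := by
    rcases Finset.mem_union.1 hc with h | h
    · exact ⟨c.1, (Finset.mem_product.1 h).1, Or.inl rfl⟩
    · obtain ⟨c', hc', rfl⟩ := Finset.mem_image.1 h
      exact ⟨c'.1, (Finset.mem_product.1 hc').1, Or.inr rfl⟩
  have hw := fun i => window L m hfit hY hy' i
  have hy'd : ∀ i, (L : ℤ) ∣ y' i := by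
    intro i
    obtain ⟨y, -, rfl⟩ := Finset.mem_image.1 hy'
    exact ⟨_, rfl⟩
  refine ⟨fun i => ?_, fun i => ?_⟩
  · obtain ⟨hw1, hw2⟩ := hw i
    rcases hcases with h | h <;> rw [h]
    · constructor <;> linarith
    · simp only [Pi.sub_apply, Pi.smul_apply, unitVec, smul_eq_mul, mul_ite, mul_one, mul_zero]
      split_ifs <;> constructor <;> linarith
  · have : (L : ℤ) ∣ c.1 i := by
      rcases hcases with h | h <;> rw [h]
      · exact hy'd i
      · simp only [Pi.sub_apply, Pi.smul_apply, smul_eq_mul]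
        exact dvd_sub (hy'd i) (dvd_mul_right _ _)
    exact (Int.mul_ediv_cancel' this).symm

end Lift

end Literature.MathematicalPhysics.QuantumFieldTheory.Balaban1983to89.NodeOTorusBlocks

end
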